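import Literature.MathematicalPhysics.QuantumFieldTheory.Balaban1983to89.B8IdxB8SubDPeriodicTowers
import Literature.MathematicalPhysics.QuantumFieldTheory.Balaban1983to89.B15LatticeCubeTorus
import Literature.MathematicalPhysics.QuantumFieldTheory.Balaban1983to89.Node00.CarriersB8SubDPer

/-!
# `Balaban1983to89.B8IdxB8SubDPeriodize` — [Balaban1985RegularSpaces] (1.3)–(1.6) p. 77 («Ω_j ⊂ T_η», «we admit the case where some domains Ω_j are equal to T_η»), Sect. F p. 98
# («□ ⊂ T_η … for every j the cube □_j is a sum of the big blocks»): PERIODISATION — THE (1.5)-OBEYING INDEX OF RECORD `Node00.IdxB8SubD θ` CARRIES THE TORUS IMAGE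
# (union of deck translates, the tree's `B15LatticeCubeTorus.periodize`) OF EVERY ADMISSIBLE TOWER, as a member whose domains are `P`-PERIODIC at every level

statement-level skeleton of published theorems with citation tags; proofs where landed; nothing here is a claim about the Yang–Mills mass gap

T. Bałaban, *Spaces of regular gauge field configurations on a lattice and gauge fixing conditions*, Commun. Math. Phys. **99** (1985) 75–102 `[Balaban1985RegularSpaces]`
— (1.3)–(1.6) p. 77, p. 77 («we consider sequences of domains Ω_j ⊂ T_η»), Sect. F p. 98 (the cube tower `□ ⊂ T_η`), (1.131) p. 99.
T. Bałaban, *Propagators and renormalization transformations for lattice gauge theories. II*, Commun. Math. Phys. **96** (1984) 223–250 `[Balaban1984PropagatorsII]` — (2.1) p. 224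
(the torus as `ℤᵈ` modulo the period lattice; the tree's periodiser `B15LatticeCubeTorus.periodize` = union of deck translates).

WHY (cell pub-ymgap, N05 [B8]; director-ym №217: «(β′-PERIODIC) is the road of record behind the [B8] display» — periodic data ON the `ℤᵈ` carrier; plan g86 PENS-217; width seat
dag-n05-w2 g6, CLAIM-2).  The periodic (1.5)-index of the road (dag-n05-w1's `Node00.IdxB8SubDPer θ P` = `{j : IdxB8SubD θ // (0 < P ∧ θ.Lᵏ ∣ P) ∧ ∀ l, IsPeriodic P (· ∈ Ω l)}`)
was typed with ONE inhabitant, print's all-torus tower `Ω ≡ ℤᵈ` (towers `Λ_l = ∅` below `k`).  This file supplies the CLASS: for every domain sequence `Ω₀ = ℤᵈ ⊃ Ω₁ ⊃ …` obeying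
(1.3)–(1.4) (`B8ConstraintBonds.DomainSeq`) whose non-trivial levels have block lattices dividing the period (`θ.Lⁿ ∣ P`, or `Ω_n ∈ {∅, ℤᵈ}`), the union of deck translates
`periodize (fun _ ↦ P) Ω` — the pull-back to `ℤᵈ` of the image of `Ω` in the torus `T_η = (ℤ/Pℤ)ᵈ` — obeys (1.3)–(1.4) AGAIN, keeps `Ω₀ = ℤᵈ`, and is `P`-periodic at every level; by
UNIVERSALITY (this seat g4, `B8IdxB8SubDRigidity.exists_idxB8SubD_of_domainSeq`) it is therefore the domain sequence of a member of `IdxB8SubD θ` with families pinned to print's level sets —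
a member satisfying `IdxB8SubDPer`'s law verbatim.  In particular print's Sect.-F cube tower `(ℤᵈ, □₁, …, □_k)` (`B8Eq131CubesAdmissible.cubeFam true θ.L a M ρ k`, r05), the geometry of
Proposition 6 «□ ⊂ T_η» read on the universal cover, is carried PERIODISED for every period `P` with `θ.Lᵏ ∣ P`, and that member is NOT the all-torus tower once the torus is wider than `□₁`.

WHAT IS PROVED (0 `def` — the periodiser is the tree's `B15LatticeCubeTorus.periodize` at the constant period vector; 0 sorry; std axioms):
* §1 bridge: `pmul_const` (`pmul (fun _ ↦ P) v = (P:ℤ)•v`), `mem_periodize_const_iff`, ★ `isPeriodic_periodize` (`T4TermwiseTorus.IsPeriodic P (· ∈ periodize (fun _ ↦ P) Ω n)`),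
  `subset_periodize_const`, `periodize_eq_self_of_isPeriodic` (periodic levels are fixed), `periodize_const_univ` ∕ `periodize_const_empty`, `blockMap_add_mul_zsmul`.
* §2 ★★ `domainSeq_periodize` (`DomainSeq L Ω → (∀ n, Lⁿ ∣ P ∨ Ω n = ∅ ∨ Ω n = univ) → DomainSeq L (periodize (fun _ ↦ P) Ω)`), `domainSeq_periodize_of_empty_above` (the form «`Lᵏ ∣ P`,
  `Ω_n = ∅` above `k`»).
* §3 ★★ `exists_idxB8SubD_periodize` (the carried member, `P`-periodic at every level, families pinned), ★ `cubeFam_eq_empty_of_lt` ∕ `exists_idxB8SubD_periodize_cubeFam` (print's cube tower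
  periodised, every centre `a`, size `M`, margin `ρ ≥ L`, depth `k ≥ 1`, period `θ.Lᵏ ∣ P`); ON THE PERIODIC CUT OF RECORD (dag-n05-w1's `Node00.IdxB8SubDPer θ P`, by its characterisation
  `Node00.exists_idxB8SubDPer_iff`): ★★ `exists_idxB8SubDPer_periodize`, ★ `exists_idxB8SubDPer_periodize_cubeFam`.
* §4 non-triviality: `periodize_const_ne_univ_of_inBox` (a box shorter than `P` in one direction never periodises to `ℤᵈ`), ★ `periodize_cubeFam_one_ne_univ` (the periodised `□₁` is a proper
  subset of `ℤᵈ` when `Lᵏ·M + 2·L·ρ·gs L (k−1) < P`).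

HONEST FRAMING: set bookkeeping on `ℤᵈ` + the universality face of `B8IdxB8SubDRigidity` BY NAME; NO estimate; nothing of Bałaban's asserted or refuted; no index ∕ pin ∕ door ∕ member model typed (the
periodic cut `IdxB8SubDPer` is dag-n05-w1's `Node00/CarriersB8SubDPer`, CONSUMED by name through its characterisation); count-neutral; N05 NOT discharged; one finite 𝕋⁴ programme at fixed ε,
Bałaban AS PRINTED — NOT continuum ∕ ℝ⁴ ∕ OS ∕ mass gap ∕ Clay.  No `sorry`, no `instance`, no `notation`. -/

noncomputable section

namespace Literature.MathematicalPhysics.QuantumFieldTheory.Balaban1983to89.B8IdxB8SubDPeriodize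

open Literature.MathematicalPhysics.QuantumLattice (blockMap)
open B7Prop1Explicit B7Prop1Local
open B8LeafModelZd (ZdIdx)
open B8ConstraintBonds (DomainSeq)
open T4TermwiseTorus (IsPeriodic)
open B15LatticeCubeTorus (periodize pmul periodize_mem_iff subset_periodize periodize_univ periodize_empty)
open B8IdxB8SubDPeriodicTowers (isPeriodic_mem_iff isPeriodic_mem_of_iff)
open B8IdxB8SubDRigidity (exists_idxB8SubD_of_domainSeq)
open B8Eq131Cubes (cube gs bLo bHi cube_eq)
open B8Eq131CubesAdmissible (cubeFam cubeFam_domainSeq cubeFam_true_zero cubeFam_of_pos)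
open Node00 (Stage3Params IdxB8SubD IdxB8SubDPer exists_idxB8SubDPer_iff)

variable {d : ℕ}

/-! ## §1 The tree's periodiser at the constant period vector `(P, …, P)` -/

section Bridge

/-- The deck translation at the constant period vector is the scalar translation `P•v`. [cite: Balaban1984PropagatorsII, (2.1) p.224] -/
theorem pmul_const (P : ℕ) (v : B7Prop1Explicit.Site d) : pmul (fun _ : Fin d => P) v = (P : ℤ) • v := by
  funext μ
  simp only [pmul, Pi.smul_apply, smul_eq_mul]

/-- Membership in the periodisation, scalar form: `x ∈ periodize (fun _ ↦ P) Ω n ↔ ∃ m, x − P•m ∈ Ω n`. [cite: Balaban1984PropagatorsII, (2.1) p.224] -/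
theorem mem_periodize_const_iff (P : ℕ) (Ω : ℕ → Set (B7Prop1Explicit.Site d)) (n : ℕ) (x : B7Prop1Explicit.Site d) :
    x ∈ periodize (fun _ : Fin d => P) Ω n ↔ ∃ m : B7Prop1Explicit.Site d, x - (P : ℤ) • m ∈ Ω n := by
  refine exists_congr fun m => ?_
  rw [pmul_const]

/-- ★ **The periodisation is `P`-periodic at every level** (in the tree's predicate of record `T4TermwiseTorus.IsPeriodic`, the law of the periodic (1.5)-index).
[cite: Balaban1984PropagatorsII, (2.1) p.224; Balaban1985RegularSpaces, p.77 («Ω_j ⊂ T_η»)] -/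
theorem isPeriodic_periodize (P : ℕ) (Ω : ℕ → Set (B7Prop1Explicit.Site d)) (n : ℕ) :
    IsPeriodic P (· ∈ periodize (fun _ : Fin d => P) Ω n) :=
  isPeriodic_mem_of_iff fun x m => by
    have h := periodize_mem_iff (P := fun _ : Fin d => P) (D := Ω) n x m
    rwa [pmul_const] at h

/-- Every level lies in its periodisation. [cite: Balaban1984PropagatorsII, (2.1) p.224] -/
theorem subset_periodize_const (P : ℕ) (Ω : ℕ → Set (B7Prop1Explicit.Site d)) (n : ℕ) : Ω n ⊆ periodize (fun _ : Fin d => P) Ω n :=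
  subset_periodize n

/-- A level that is ALREADY `P`-periodic is fixed by the periodisation. [cite: Balaban1984PropagatorsII, (2.1) p.224] -/
theorem periodize_eq_self_of_isPeriodic {P : ℕ} {Ω : ℕ → Set (B7Prop1Explicit.Site d)} {n : ℕ} (h : IsPeriodic P (· ∈ Ω n)) :
    periodize (fun _ : Fin d => P) Ω n = Ω n := by
  refine Set.Subset.antisymm (fun x hx => ?_) (subset_periodize_const P Ω n)
  obtain ⟨m, hm⟩ := (mem_periodize_const_iff P Ω n x).1 hx
  exact (B8IdxB8SubDPeriodicTowers.isPeriodic_mem_sub_iff h x m).1 hm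

/-- The periodisation of a level `= ℤᵈ` is `ℤᵈ`. [cite: Balaban1984PropagatorsII, (2.1) p.224] -/
theorem periodize_const_univ (P : ℕ) {Ω : ℕ → Set (B7Prop1Explicit.Site d)} {n : ℕ} (h : Ω n = Set.univ) :
    periodize (fun _ : Fin d => P) Ω n = Set.univ :=
  periodize_univ h

/-- The periodisation of an empty level is empty. [cite: Balaban1984PropagatorsII, (2.1) p.224] -/
theorem periodize_const_empty (P : ℕ) {Ω : ℕ → Set (B7Prop1Explicit.Site d)} {n : ℕ} (h : Ω n = ∅) :
    periodize (fun _ : Fin d => P) Ω n = ∅ :=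
  periodize_empty h

/-- **Block labels translate**: `blockMap N (x + (N·q)•m) = blockMap N x + q•m` (`N ≥ 1`) — a deck translation by a multiple of the block side permutes the blocks.
[cite: Balaban1985RegularSpaces, (1.4) p.77 («Ω_j = Bʲ(Ω_j^{(j)})»), p.98] -/
theorem blockMap_add_mul_zsmul {N : ℕ} (hN : 1 ≤ N) (q : ℤ) (x m : B7Prop1Explicit.Site d) :
    blockMap N (x + ((N : ℤ) * q) • m) = blockMap N x + q • m := by
  have hN' : (N : ℤ) ≠ 0 := by exact_mod_cast (show N ≠ 0 by omega)
  funext i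
  simp only [blockMap, Pi.add_apply, Pi.smul_apply, smul_eq_mul]
  rw [show x i + (N : ℤ) * q * m i = x i + (N : ℤ) * (q * m i) by ring, Int.add_mul_ediv_left _ _ hN']

end Bridge

/-! ## §2 (1.3)–(1.4) survive periodisation -/

section DomainSeqPeriodize

/-- ★★ **(1.3)–(1.4) SURVIVE PERIODISATION**: if `Ω` obeys `DomainSeq L Ω` and every level is either trivial (`∅` or `ℤᵈ`) or has its block lattice dividing the period (`Lⁿ ∣ P`), then the
union of deck translates `periodize (fun _ ↦ P) Ω` obeys `DomainSeq L` again: nesting and the (1.4) collar hold translate by translate (they are translation-invariant and local), and block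
saturation holds because a deck translation by `P ∈ Lⁿℤ` permutes the `Lⁿ`-blocks. [cite: Balaban1985RegularSpaces, (1.3)–(1.4) p.77, p.77 («Ω_j ⊂ T_η»), p.98; Balaban1984PropagatorsII, (2.1) p.224] -/
theorem domainSeq_periodize {L P : ℕ} {Ω : ℕ → Set (B7Prop1Explicit.Site d)} (hΩ : DomainSeq L Ω)
    (hP : ∀ n, L ^ n ∣ P ∨ Ω n = ∅ ∨ Ω n = Set.univ) : DomainSeq L (periodize (fun _ : Fin d => P) Ω) where
  anti n x hx := by
    obtain ⟨m, hm⟩ := (mem_periodize_const_iff P Ω (n + 1) x).1 hx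
    exact (mem_periodize_const_iff P Ω n x).2 ⟨m, hΩ.anti n hm⟩
  sat n x y hxy hx := by
    rcases hP n with ⟨q, hq⟩ | hn | hn
    · obtain ⟨m, hm⟩ := (mem_periodize_const_iff P Ω n x).1 hx
      refine (mem_periodize_const_iff P Ω n y).2 ⟨m, hΩ.sat n (x - (P : ℤ) • m) (y - (P : ℤ) • m) ?_ hm⟩
      rcases Nat.eq_zero_or_pos L with hL | hL
      · -- degenerate block size `L = 0`: `Lⁿ ∣ P` forces `P = 0` unless `n = 0`
        rcases Nat.eq_zero_or_pos n with hn0 | hn0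
        · subst hn0
          simp only [pow_zero] at hxy ⊢
          have hb : ∀ z : B7Prop1Explicit.Site d, blockMap 1 z = z := fun z => by
            funext i; simp [blockMap]
          rw [hb, hb] at hxy ⊢
          rw [hxy]
        · subst hL
          have hP0 : P = 0 := by
            rw [zero_pow (by omega), zero_mul] at hq; exact hq
          subst hP0
          simpa using hxy
      · have hLn : 1 ≤ L ^ n := Nat.one_le_pow n L hL
        have hPq : ((P : ℕ) : ℤ) = ((L ^ n : ℕ) : ℤ) * (q : ℤ) := by rw [hq]; push_cast; ring
        have hx' : x - (P : ℤ) • m = x + (((L ^ n : ℕ) : ℤ) * (-(q : ℤ))) • m := by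
          rw [hPq, sub_eq_add_neg, ← neg_smul]; congr 1; ring
        have hy' : y - (P : ℤ) • m = y + (((L ^ n : ℕ) : ℤ) * (-(q : ℤ))) • m := by
          rw [hPq, sub_eq_add_neg, ← neg_smul]; congr 1; ring
        rw [hx', hy', blockMap_add_mul_zsmul hLn, blockMap_add_mul_zsmul hLn, hxy]
    · rw [periodize_const_empty P hn] at hx; exact absurd hx (Set.notMem_empty x)
    · rw [periodize_const_univ P hn]; exact Set.mem_univ y
  sep n x t hx ht := by
    obtain ⟨m, hm⟩ := (mem_periodize_const_iff P Ω (n + 1) x).1 hx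
    refine (mem_periodize_const_iff P Ω n (x + t)).2 ⟨m, ?_⟩
    rw [add_sub_right_comm]
    exact hΩ.sep n _ t hm ht

/-- **The «finitely many levels» form**: (1.3)–(1.4), `Lᵏ ∣ P`, and `Ω_n = ∅` above depth `k` ⇒ the periodisation obeys (1.3)–(1.4) (every `Lⁿ`, `n ≤ k`, divides `Lᵏ ∣ P`).
[cite: Balaban1985RegularSpaces, (1.3)–(1.4) p.77, p.98; Balaban1984PropagatorsII, (2.1) p.224] -/
theorem domainSeq_periodize_of_empty_above {L P k : ℕ} {Ω : ℕ → Set (B7Prop1Explicit.Site d)} (hΩ : DomainSeq L Ω) (hdvd : L ^ k ∣ P)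
    (habove : ∀ n, k < n → Ω n = ∅) : DomainSeq L (periodize (fun _ : Fin d => P) Ω) :=
  domainSeq_periodize hΩ fun n => by
    rcases Nat.lt_or_ge k n with hn | hn
    · exact Or.inr (Or.inl (habove n hn))
    · exact Or.inl ((pow_dvd_pow L hn).trans hdvd)

end DomainSeqPeriodize

/-! ## §3 The periodisation is carried by a `P`-periodic member of the index of record -/

section Carried

variable (θ : Stage3Params)

/-- ★★ **UNIVERSALITY, PERIODISED — THE TORUS IMAGE OF EVERY ADMISSIBLE TOWER IS A `P`-PERIODIC (1.5)-MEMBER**: for every spacing `η > 0` and depth `k ≥ 1` with `Lᵏη ≤ 1`, every `Ω` with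
`Ω₀ = ℤᵈ` obeying (1.3)–(1.4) and the tiling law on its non-trivial levels, there is `j : IdxB8SubD θ` with `j.η = η`, `j.k = k`, `j.Ω = periodize (fun _ ↦ P) Ω` — `P`-PERIODIC AT EVERY
LEVEL — and families pinned to print's level sets (hence `j.Λs ∕ j.Λb` periodic in level labels by `B8IdxB8SubDPeriodicTowers`).  This is dag-n05-w1's `IdxB8SubDPer` law verbatim (with
`0 < P`, `θ.Lᵏ ∣ P`). [cite: Balaban1985RegularSpaces, (1.3)–(1.6) p.77, p.77 («Ω_j ⊂ T_η», «Ω_j = T_η»), (1.68) p.88; Balaban1984PropagatorsII, (2.1) p.224] -/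
theorem exists_idxB8SubD_periodize {η : ℝ} (hη : 0 < η) {k : ℕ} (hk : 1 ≤ k) (hscale : (θ.L : ℝ) ^ k * η ≤ 1) {P : ℕ}
    {Ω : ℕ → Set (B7Prop1Explicit.Site θ.D)} (hΩ0 : Ω 0 = Set.univ) (hΩ : DomainSeq θ.L Ω) (hP : ∀ n, θ.L ^ n ∣ P ∨ Ω n = ∅ ∨ Ω n = Set.univ) :
    ∃ j : IdxB8SubD θ, j.1.1.1.1.η = η ∧ j.1.1.1.1.k = k ∧ j.1.1.1.1.Ω = periodize (fun _ : Fin θ.D => P) Ω ∧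
      (∀ l, IsPeriodic P (· ∈ j.1.1.1.1.Ω l)) ∧ j.1.1.1.1.Λs = B11Eq7Convention.Lam θ.L (periodize (fun _ : Fin θ.D => P) Ω) := by
  obtain ⟨j, h1, h2, h3, h4⟩ := exists_idxB8SubD_of_domainSeq θ hη hk hscale (Ω := periodize (fun _ : Fin θ.D => P) Ω)
    (periodize_const_univ P hΩ0) (domainSeq_periodize hΩ hP)
  exact ⟨j, h1, h2, h3, fun l => by rw [h3]; exact isPeriodic_periodize P Ω l, h4⟩

/-- Print's cube tower is EMPTY above its depth (`cubeFam … k n = ∅` for `n > k`). [cite: Balaban1985RegularSpaces, Sect. F p.98, (1.131) p.99] -/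
theorem cubeFam_eq_empty_of_lt (top : Bool) (L : ℕ) (a : B7Prop1Explicit.Site d) (M ρ : ℕ) {k n : ℕ} (hn : k < n) :
    cubeFam top L a M ρ k n = ∅ := by
  have h : ¬ n ≤ k := by omega
  simp [cubeFam, h]

/-- ★ **PRINT'S SECT.-F TOWER `(ℤᵈ, □₁, …, □_k)` PERIODISED IS A `P`-PERIODIC (1.5)-MEMBER** for every centre `a`, size `M`, margin `ρ ≥ L`, depth `k ≥ 1` and every period with `θ.Lᵏ ∣ P`
(spacing `η = L⁻ᵏ`): Proposition 6's geometry «□ ⊂ T_η» read on the universal cover of the torus of side `P`. [cite: Balaban1985RegularSpaces, Sect. F p.98, (1.131) p.99, (1.3)–(1.6) p.77, p.77 («Ω_j ⊂ T_η»)] -/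
theorem exists_idxB8SubD_periodize_cubeFam (a : B7Prop1Explicit.Site θ.D) (M : ℕ) {ρ : ℕ} (hρ : θ.L ≤ ρ) {k : ℕ} (hk : 1 ≤ k) {P : ℕ} (hdvd : θ.L ^ k ∣ P) :
    ∃ j : IdxB8SubD θ, j.1.1.1.1.η = ((θ.L : ℝ)⁻¹) ^ k ∧ j.1.1.1.1.k = k ∧ j.1.1.1.1.Ω = periodize (fun _ : Fin θ.D => P) (cubeFam true θ.L a M ρ k) ∧
      (∀ l, IsPeriodic P (· ∈ j.1.1.1.1.Ω l)) ∧ j.1.1.1.1.Λs = B11Eq7Convention.Lam θ.L (periodize (fun _ : Fin θ.D => P) (cubeFam true θ.L a M ρ k)) := by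
  have hL : 1 ≤ θ.L := le_trans (by norm_num) θ.two_le_L
  have hL0 : (0 : ℝ) < θ.L := by exact_mod_cast (show 0 < θ.L by omega)
  have hη : (0 : ℝ) < ((θ.L : ℝ)⁻¹) ^ k := pow_pos (inv_pos.mpr hL0) k
  have hscale : (θ.L : ℝ) ^ k * ((θ.L : ℝ)⁻¹) ^ k ≤ 1 := by
    rw [← mul_pow, mul_inv_cancel₀ hL0.ne', one_pow]
  refine exists_idxB8SubD_periodize θ hη hk hscale (cubeFam_true_zero θ.L a M ρ k) (cubeFam_domainSeq true hL a M hρ k) fun n => ?_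
  rcases Nat.lt_or_ge k n with hn | hn
  · exact Or.inr (Or.inl (cubeFam_eq_empty_of_lt true θ.L a M ρ hn))
  · exact Or.inl ((pow_dvd_pow θ.L hn).trans hdvd)

/-- ★★ **ON THE PERIODIC CUT OF RECORD**: every `Ω` with `Ω₀ = ℤᵈ`, (1.3)–(1.4) and `Ω_n = ∅` above depth `k`, periodised with a period `P > 0`, `θ.Lᵏ ∣ P`, is the domain sequence of a member of
dag-n05-w1's `Node00.IdxB8SubDPer θ P` at every spacing `Lᵏη ≤ 1` (through `Node00.exists_idxB8SubDPer_iff`). [cite: Balaban1985RegularSpaces, (1.3)–(1.6) p.77, p.77 («Ω_j ⊂ T_η»); Balaban1984PropagatorsII, (2.1) p.224] -/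
theorem exists_idxB8SubDPer_periodize {η : ℝ} (hη : 0 < η) {k : ℕ} (hk : 1 ≤ k) (hscale : (θ.L : ℝ) ^ k * η ≤ 1) {P : ℕ} (hP : 0 < P)
    (hdvd : θ.L ^ k ∣ P) {Ω : ℕ → Set (B7Prop1Explicit.Site θ.D)} (hΩ0 : Ω 0 = Set.univ) (hΩ : DomainSeq θ.L Ω) (habove : ∀ n, k < n → Ω n = ∅) :
    ∃ j : IdxB8SubDPer θ P, j.1.1.1.1.1.η = η ∧ j.1.1.1.1.1.k = k ∧ j.1.1.1.1.1.Ω = periodize (fun _ : Fin θ.D => P) Ω :=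
  (exists_idxB8SubDPer_iff θ η k _).2 ⟨⟨hη, hk, hscale, periodize_const_univ P hΩ0, domainSeq_periodize_of_empty_above hΩ hdvd habove⟩,
    ⟨hP, hdvd⟩, fun l => isPeriodic_periodize P Ω l⟩

/-- ★ **PRINT'S CUBE TOWER PERIODISED IS A MEMBER OF THE PERIODIC CUT** `Node00.IdxB8SubDPer θ P` (centre `a`, size `M`, margin `ρ ≥ L`, depth `k ≥ 1`, period `P > 0` with `θ.Lᵏ ∣ P`, spacing
`L⁻ᵏ`) — Proposition 6's «□ ⊂ T_η» on the universal cover, as an element of the road's index. [cite: Balaban1985RegularSpaces, Sect. F p.98, (1.131) p.99, (1.3)–(1.6) p.77, p.77 («Ω_j ⊂ T_η»)] -/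
theorem exists_idxB8SubDPer_periodize_cubeFam (a : B7Prop1Explicit.Site θ.D) (M : ℕ) {ρ : ℕ} (hρ : θ.L ≤ ρ) {k : ℕ} (hk : 1 ≤ k) {P : ℕ} (hP : 0 < P)
    (hdvd : θ.L ^ k ∣ P) :
    ∃ j : IdxB8SubDPer θ P, j.1.1.1.1.1.η = ((θ.L : ℝ)⁻¹) ^ k ∧ j.1.1.1.1.1.k = k ∧
      j.1.1.1.1.1.Ω = periodize (fun _ : Fin θ.D => P) (cubeFam true θ.L a M ρ k) := by
  have hL : 1 ≤ θ.L := le_trans (by norm_num) θ.two_le_L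
  have hL0 : (0 : ℝ) < θ.L := by exact_mod_cast (show 0 < θ.L by omega)
  have hη : (0 : ℝ) < ((θ.L : ℝ)⁻¹) ^ k := pow_pos (inv_pos.mpr hL0) k
  have hscale : (θ.L : ℝ) ^ k * ((θ.L : ℝ)⁻¹) ^ k ≤ 1 := by
    rw [← mul_pow, mul_inv_cancel₀ hL0.ne', one_pow]
  exact exists_idxB8SubDPer_periodize θ hη hk hscale hP hdvd (cubeFam_true_zero θ.L a M ρ k) (cubeFam_domainSeq true hL a M hρ k)
    fun n hn => cubeFam_eq_empty_of_lt true θ.L a M ρ hn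

end Carried

/-! ## §4 Non-triviality: the periodised cube tower is NOT the all-torus tower once the torus is wider than `□₁` -/

section NonTrivial

/-- **A box shorter than the period in one direction never periodises to `ℤᵈ`**: if `Ω n = {x | InBox lo hi x}` with `hi i₀ − lo i₀ + 1 < P` for some `i₀`, then the site one step
below the box in direction `i₀` lies in no deck translate. [cite: Balaban1984PropagatorsII, (2.1) p.224; Balaban1985RegularSpaces, Sect. F p.98] -/
theorem periodize_const_ne_univ_of_inBox {P : ℕ} {Ω : ℕ → Set (B7Prop1Explicit.Site d)} {n : ℕ} {lo hi : B7Prop1Explicit.Site d}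
    (hΩ : Ω n = {x | InBox lo hi x}) {i₀ : Fin d} (hlen : hi i₀ - lo i₀ + 1 < (P : ℤ)) :
    periodize (fun _ : Fin d => P) Ω n ≠ Set.univ := by
  intro huniv
  have hx : (fun i => if i = i₀ then lo i₀ - 1 else lo i) ∈ periodize (fun _ : Fin d => P) Ω n := by
    rw [huniv]; exact Set.mem_univ _
  obtain ⟨m, hm⟩ := (mem_periodize_const_iff P Ω n _).1 hx
  rw [hΩ] at hm
  obtain ⟨h1, h2⟩ := hm i₀
  have h1' : lo i₀ ≤ lo i₀ - 1 - (P : ℤ) * m i₀ := by simpa using h1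
  have h2' : lo i₀ - 1 - (P : ℤ) * m i₀ ≤ hi i₀ := by simpa using h2
  -- `lo ≤ lo − 1 − P·m ≤ hi` forces `−P·m ∈ [1, hi − lo + 1] ⊂ (0, P)`, impossible for a multiple of `P`
  rcases le_or_gt 0 (m i₀) with h | h
  · have h0 : (0 : ℤ) ≤ (P : ℤ) * m i₀ := mul_nonneg (by positivity) h
    linarith
  · have h0 : (P : ℤ) * m i₀ ≤ (P : ℤ) * (-1) := mul_le_mul_of_nonneg_left (by omega) (by positivity)
    linarith

/-- ★ **THE PERIODISED `□₁` IS A PROPER SUBSET OF `ℤᵈ` WHEN THE TORUS IS WIDER THAN `□₁`** (`1 ≤ k`, `0 < d`): with `□₁`'s fine side `Lᵏ·M + 2·L·ρ·gs L (k−1)` (r05's `cube_eq`: the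
margin-`L·ρ·gs L (k−1)` box about `Lᵏ·[a, a + M)`), `Lᵏ·M + 2·L·ρ·gs L (k−1) < P` ⇒ `periodize (fun _ ↦ P) (cubeFam true L a M ρ k) 1 ≠ univ` — so the member of `exists_idxB8SubD_periodize_cubeFam` is
a genuinely NESTED periodic tower, not the all-torus tower. [cite: Balaban1985RegularSpaces, Sect. F p.98 («□ ⊂ T_η»), (1.131) p.99; Balaban1984PropagatorsII, (2.1) p.224] -/
theorem periodize_cubeFam_one_ne_univ {L : ℕ} {a : B7Prop1Explicit.Site d} {M ρ k P : ℕ} (hk : 1 ≤ k) (hd : 0 < d)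
    (hP : ((L : ℤ) ^ k) * M + 2 * ((L : ℤ) * (ρ * gs L (k - 1))) < (P : ℤ)) :
    periodize (fun _ : Fin d => P) (cubeFam true L a M ρ k) 1 ≠ Set.univ := by
  have h1 : cubeFam true L a M ρ k 1 = {x | InBox (bLo L a k (L ^ 1 * (ρ * gs L (k - 1)))) (bHi L a M k (L ^ 1 * (ρ * gs L (k - 1)))) x} := by
    rw [cubeFam_of_pos true L a M ρ le_rfl hk, cube_eq hk]
  refine periodize_const_ne_univ_of_inBox h1 (i₀ := ⟨0, hd⟩) ?_
  simp only [bLo, bHi, pow_one]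
  push_cast
  nlinarith

end NonTrivial

end Literature.MathematicalPhysics.QuantumFieldTheory.Balaban1983to89.B8IdxB8SubDPeriodize

end
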